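import Literature.AlgebraicGeometry.Resolution.ArithmeticalThreefolds
import Literature.AlgebraicGeometry.Resolution.ExcellentRings
import Mathlib.RingTheory.Polynomial.Basic
import Mathlib.Algebra.CharP.Lemmas
import HarnessLib

/-!
# Cossart–Piltant: the local theorem (journal Thm. 1.5) and the reduction of (LU) to it

Topic: `Literature/AlgebraicGeometry/Resolution`. Fourth layer of the decomposition of the named
fact `CossartPiltant2019` (layers 1–2: `ArithmeticalThreefolds.lean`; layer 3:
`QuasiExcellentSchemes.lean`; definitions: `ExcellentRings.lean`). Numbering: journal
(= arXiv v2) first, arXiv v1 (the held text, quoted) in parentheses, as in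
`ArithmeticalThreefolds.lean`.

The technical core of Cossart–Piltant 2019 (Chapters 5–9, some 200 pages) is the LOCAL theorem,
journal Thm. 1.5 = arXiv v1 Thm. 1.4 (p. 4 of v1):

> "Let `(S, m_S, k)` be an excellent regular local ring of dimension `n = 3`, quotient field
> `K := QF(S)` and residue characteristic `char k = p > 0`. Let
> `h := X^p + f₁X^{p-1} + ⋯ + f_p ∈ S[X]`, `f₁, …, f_p ∈ S` be a reduced polynomial,
> `𝒳 := Spec(S[X]/(h))` and `L := Tot(S[X]/(h))` be its total quotient ring. Assume that `h`
> satisfies one of the following assumptions: (i) `char K = p` and `f₁ = ⋯ = f_{p-1} = 0`, or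
> (ii) `𝒳` is `G`-invariant, where `G := Aut_K(L) = ℤ/p`. Let `μ` be a valuation of `L` which
> is centered in `m_S`. There exists a composition of local Hironaka-permissible blowing ups
> `(𝒳 =: 𝒳₀, x₀) ← (𝒳₁, x₁) ← ⋯ ← (𝒳_r, x_r)`, where `xᵢ ∈ 𝒳ᵢ` is the center of `μ`, such that
> `(𝒳_r, x_r)` is regular."

and journal Prop. 4.10 = v1 Prop. 4.8 ("Theorem 1.4 implies Theorem 1.1", v1 p. 53) reduces
the main theorem to it: "By proposition 4.6 [journal 4.8], it is sufficient to prove that (LU)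
holds for every complete local domain `(A, m, k)` of dimension three. Let `(𝒪_v, m_v, k_v)` be
the given valuation ring as in (LU). We may assume here that `char k_v = p > 0`, the
equicharacteristic zero version of theorem 1.1 being known", followed (v1 pp. 54) by Cohen
structure (`A` finite over a complete regular local `S` of dimension `3`), reduction to
`K | F` separable via Thm. 1.4 (i), ramification theory of valuations, Galois approximation
(journal Prop. 4.13 = v1 Prop. 4.9), principalization (journal Prop. 4.4 = v1 Prop. 4.3) and
the chain `(LU v₀) ⇒ (LU v₀ⁱ) ⇒ (LU v₀ʳ) ⇒ (LU vʳ) ⇒ (LU vⁱ) ⇒ (LU v)` whose step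
`(LU v₀ʳ) ⇒ (LU vʳ)` is Thm. 1.4 (ii), the other steps being [CoP1] Cor. 7.3, Props. 6.3, 9.1,
9.3.

## Content (namespace `Literature.AlgGeom`)

* `CossartPiltant2019Local` — NAMED FACT: journal Thm. 1.5 (v1 Thm. 1.4) in WEAK
  local-uniformization form and in the case `L` a field (see Faithfulness).
* `CossartPiltant2019ReductionP` — NAMED FACT: the reduction of journal Prop. 4.10's proof in
  residue characteristic `p > 0`: `CossartPiltant2019Local →` (LU) for every complete
  Noetherian local domain of dimension three with residue field of characteristic `p`.
* `CossartPiltant2019LUCompleteChar0` — NAMED FACT: (LU) for complete Noetherian local domains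
  of dimension three with residue field of characteristic `0` ("the equicharacteristic zero
  version of theorem 1.1 being known": Hironaka 1964; for arbitrary Noetherian quasi-excellent
  `ℚ`-schemes Temkin 2008), by the valuative criterion as for `CossartPiltant2019LUComplete3`.
* PROVED assemblies: `CossartPiltant2019LUComplete3.of_local`
  (`Local → ReductionP → LUCompleteChar0 → CossartPiltant2019LUComplete3`, by the dichotomy
  "the residue field of a local ring has characteristic `0` or a prime") and
  `cossartPiltant2019_of_local` (all four layers:
  `Local → ReductionP → LUCompleteChar0 → LU3OfComplete → CossartJannsenSaito2020 → Patching →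
  CossartPiltant2019`).

## Faithfulness notes

* Hypotheses of `CossartPiltant2019Local`, rendered: `S` a regular local ring (Mathlib
  `IsRegularLocalRing`; we also assume `IsDomain S`, a theorem for regular local rings not yet in
  Mathlib — a harmless extra hypothesis) which is excellent (`IsExcellentRing`,
  `ExcellentRings.lean`) of Krull dimension `3` with residue field of characteristic `p`,
  `p` prime; `K` a fraction field of `S`; `h ∈ S[X]` monic of degree `p`; `L ⊇ K` a field
  generated over `K` by a root `x` of `h` with `h` irreducible over `K` — this is the CASE
  "`h` irreducible" of the printed "`h` reduced, `L = Tot(S[X]/(h))`" (then `L = K[X]/(h)` is a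
  field and `S[X]/(h) = S[x] ⊆ L`); (i) is "`char K = p` and the coefficients of
  `X¹, …, X^{p-1}` vanish"; (ii) is "`Aut_K(L)` has order `p` (so is `ℤ/p`) and `S[x] ⊆ L` is
  stable under it"; "`μ` a valuation of `L` centered in `m_S`" is a valuation subring `O ∋ S` of
  `L` with `v(s) < 1` for `s ∈ m_S`.
* Conclusion, WEAKENED to its local-uniformization content: there is a finite `t ⊆ L` with
  `T := S[x][t] ⊆ 𝒪_μ` and `T_{m_μ ∩ T}` regular. The printed conclusion implies it: each local
  blowing up replaces `𝒪_{𝒳ᵢ,xᵢ}` by the localisation at the centre of `μ` of a finitely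
  generated `𝒪_{𝒳ᵢ,xᵢ}`-subalgebra of `L`, elements inverted on the way are `μ`-units, and
  `𝒪_{𝒳,x₀} = S[x]_{x₀}`; so `𝒪_{𝒳_r,x_r} = T_{m_μ ∩ T}` for some `T = S[x][t] ⊆ 𝒪_μ`, regular.
  Hironaka-permissibility of the centres and the blow-up structure are NOT vendored: the
  tower of local blowing ups itself is now expressible (`LocalBlowup.lean`: `IsLocalBlowup`,
  `IsLocalBlowupAlong`, with `exists_adjoin_regular_of_tower` proving that such a tower ending
  in a regular local ring yields exactly the `T = S[x][t]` form below; `AffineBlowup.lean`,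
  `Blowups.lean` for the scheme-level blowing ups), but Hironaka-permissibility needs the
  multiplicity function `m(x)` (Hilbert–Samuel multiplicity / order of `h`), not formalized.
  Restricting to irreducible `h` and weakening the conclusion make the fact WEAKER than the
  source.
* `CossartPiltant2019ReductionP` has the weak `CossartPiltant2019Local` as antecedent. The
  printed proof of Prop. 4.10 consumes Thm. 1.5 only through "(LU vʳ) holds" for the degree-`p`
  steps of the ramification tower (v1 p. 54: "Theorem 1.4 (ii) states that (LU vʳ) holds";
  the purely inseparable steps likewise via (i)), i.e. through the local-uniformization content
  rendered above, applied to excellent regular local rings `S` of dimension three that are local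
  uniformizations at the previous level; the residue-characteristic-`p` restriction is the
  printed "We may assume here that `char k_v = p > 0`" (`k_v ⊇ k`, so `char k_v = char k`). It is
  vendored as ONE named fact citing the proof of Prop. 4.10; its own inputs (Props. 4.4, 4.13,
  [CoP1] §§6–9, [ZS2] §12, [NSp]) are not separated here.
* Sizes: `CossartPiltant2019Local` is the core (XL); `CossartPiltant2019ReductionP` is L/XL
  ([CoP1] is a 100-page paper); `CossartPiltant2019LUCompleteChar0` is Hironaka's theorem for
  spectra of complete local rings plus the valuative criterion (XL).

## Sources

* V. Cossart, O. Piltant, J. Algebra 529 (2019) 268–535 = arXiv:1412.0868: journal Thm. 1.5,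
  Props. 4.8, 4.10, 4.13 (arXiv v1, held: Thm. 1.4 p. 4; Prop. 4.6 p. 52; Prop. 4.8 and its
  proof pp. 53–54; Prop. 4.9 p. 54). [CossartPiltant2019]
* V. Cossart, O. Piltant, *Resolution of singularities of threefolds in positive
  characteristic I*, J. Algebra 320 (2008) 1051–1082 ([CoP1]). [CossartPiltant2008]
* H. Hironaka, Ann. of Math. 79 (1964). [Hironaka1964]
* M. Temkin, Adv. Math. 219 (2008) 488–522, Thm. 1.1. [Temkin2008]
-/

noncomputable section

open IsLocalRing Polynomial

namespace Literature.AlgebraicGeometry.Resolution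

universe u

/-! ## The local theorem -/

/-- NAMED FACT — **Cossart–Piltant 2019, journal Thm. 1.5 (arXiv v1 Thm. 1.4), weak
local-uniformization form, case `h` irreducible.** For a prime `p`, an excellent regular local
domain `S` of Krull dimension `3` with residue field of characteristic `p`, a fraction field `K`
of `S`, a monic `h ∈ S[X]` of degree `p` irreducible over `K`, a field `L = K(x)` generated by a
root `x` of `h`, such that (i) `char K = p` and `h = X^p + f_p`, or (ii) `Aut_K(L)` has order
`p` and leaves `S[x]` stable; and for every valuation ring `𝒪_μ` of `L` containing `S` and
centered in `m_S`: there is a finite `t ⊆ L` with `S[x][t] ⊆ 𝒪_μ` whose localisation at the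
centre `m_μ ∩ S[x][t]` is a regular local ring. (Printed conclusion: a composition of local
Hironaka-permissible blowing ups along the centres of `μ` ending with `(𝒳_r, x_r)` regular —
it implies the above; see the module docstring.) Users take `(h : CossartPiltant2019Local)`.
[cite: CossartPiltant2019, Thm. 1.5 (arXiv v1: Thm. 1.4)] -/
def CossartPiltant2019Local : Prop :=
  ∀ (p : ℕ), p.Prime →
  ∀ (S : Type u) [CommRing S] [IsDomain S] [IsRegularLocalRing S],
    IsExcellentRing S → ringKrullDim S = 3 → CharP (ResidueField S) p →
  ∀ (K : Type u) [Field K] [Algebra S K] [IsFractionRing S K]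
    (L : Type u) [Field L] [Algebra K L] [Algebra S L] [IsScalarTower S K L]
    (h : S[X]) (x : L),
    h.Monic → h.natDegree = p → Irreducible (h.map (algebraMap S K)) → aeval x h = 0 →
    Algebra.adjoin K ({x} : Set L) = ⊤ →
    ((CharP K p ∧ ∀ i, 0 < i → i < p → h.coeff i = 0) ∨
      (Nat.card (L ≃ₐ[K] L) = p ∧
        ∀ σ : L ≃ₐ[K] L, ∀ y ∈ Algebra.adjoin S ({x} : Set L),
          σ y ∈ Algebra.adjoin S ({x} : Set L))) →
  ∀ (O : ValuationSubring L), (∀ s : S, algebraMap S L s ∈ O) →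
    (∀ s ∈ maximalIdeal S, O.valuation (algebraMap S L s) < 1) →
    ∃ (t : Finset L) (ht : (Algebra.adjoin S (insert x (t : Set L))).toSubring ≤ O.toSubring),
      IsRegularLocalRing (Localization.AtPrime
        (Ideal.comap (Subring.inclusion ht) (maximalIdeal O)))

/-! ## The reduction of (LU) for complete local domains to the local theorem -/

/-- NAMED FACT — **Cossart–Piltant 2019, proof of journal Prop. 4.10 (arXiv v1 Prop. 4.8), the
residue characteristic `p > 0` case**: "it is sufficient to prove that (LU) holds for every
complete local domain `(A,m,k)` of dimension three … We may assume here that `char k_v = p > 0`",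
which the rest of §4.2 derives from the local theorem (Cohen structure theorem, reduction to a
separable extension of the fraction field of a complete regular local `S ⊆ A` by case (i),
ramification theory of valuations [ZS2] §12, Galois approximation Prop. 4.13 [v1 4.9],
principalization Prop. 4.4 [v1 4.3], case (ii) for the totally ramified degree-`p` steps, and
[CoP1] Cor. 7.3, Props. 6.3, 9.1, 9.3). Vendored as the implication from the weak local theorem
`CossartPiltant2019Local` to (LU) (`CPLocalUniformization`) for every complete Noetherian
local domain of Krull dimension `3` whose residue field has prime characteristic `p`.
Users take `(h : CossartPiltant2019ReductionP)`.
[cite: CossartPiltant2019, proof of Prop. 4.10 (arXiv v1: Prop. 4.8), §4.2] -/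
def CossartPiltant2019ReductionP : Prop :=
  CossartPiltant2019Local.{u} →
    ∀ (p : ℕ), p.Prime →
    ∀ (A : Type u) [CommRing A] [IsDomain A] [IsLocalRing A] [IsNoetherianRing A]
      [IsAdicComplete (maximalIdeal A) A],
      ringKrullDim A = 3 → CharP (ResidueField A) p → CPLocalUniformization A

/-- NAMED FACT — **(LU) for complete local domains of dimension three of residue
characteristic zero** (Cossart–Piltant 2019, proof of journal Prop. 4.10 = arXiv v1
Prop. 4.8: "We may assume here that `char k_v = p > 0`, the equicharacteristic zero version of
theorem 1.1 being known" — a local ring whose residue field has characteristic `0` contains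
`ℚ`; resolution of such complete local schemes is Hironaka 1964, and for all Noetherian
quasi-excellent `ℚ`-schemes Temkin 2008, Thm. 1.1: "Let `X` be a noetherian scheme of
characteristic zero, then the following conditions are equivalent: (i) `X` is quasi-excellent;
(ii) any integral scheme of finite type over `X` admits a desingularization", the local case
being Hironaka's Main Theorem I, ibid. Thm. 2.3.6; a complete Noetherian local ring is excellent
and contains `ℚ` when its residue field has characteristic `0`; (LU) follows by the valuative
criterion of properness as for `CossartPiltant2019LUComplete3`). For every complete Noetherian
local domain `A` of Krull dimension `3` with `char (A/𝔪) = 0`, `CPLocalUniformization A`. Users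
take `(h : CossartPiltant2019LUCompleteChar0)`.
[cite: CossartPiltant2019, proof of Prop. 4.10 (arXiv v1: Prop. 4.8), first paragraph]
[cite: Temkin2008, Thm. 1.1 and Thm. 2.3.6] -/
def CossartPiltant2019LUCompleteChar0 : Prop :=
  ∀ (A : Type u) [CommRing A] [IsDomain A] [IsLocalRing A] [IsNoetherianRing A]
    [IsAdicComplete (maximalIdeal A) A],
    ringKrullDim A = 3 → CharZero (ResidueField A) → CPLocalUniformization A

/-! ## Assembly -/

/-- **(LU) for complete local domains of dimension three from the local theorem**: the residue
field of `A` has characteristic `0` (`CossartPiltant2019LUCompleteChar0`) or a prime `p`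
(`CossartPiltant2019ReductionP` applied to `CossartPiltant2019Local`).
[cite: CossartPiltant2019, proof of Prop. 4.10 (arXiv v1: Prop. 4.8)] -/
theorem CossartPiltant2019LUComplete3.of_local (hloc : CossartPiltant2019Local.{u})
    (hred : CossartPiltant2019ReductionP.{u}) (h0 : CossartPiltant2019LUCompleteChar0.{u}) :
    CossartPiltant2019LUComplete3.{u} := by
  intro A _ _ _ _ _ hdim
  obtain ⟨p, hp⟩ := CharP.exists (ResidueField A)
  rcases CharP.char_is_prime_or_zero (ResidueField A) p with hprime | rfl
  · exact hred hloc p hprime A hdim hp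
  · haveI := hp
    haveI : CharZero (ResidueField A) := CharP.charP_to_charZero (ResidueField A)
    exact h0 A hdim ‹_›

/-- **All four layers**: the local theorem, the reduction, the residue-characteristic-zero
case, descent (journal Prop. 4.8), surface resolution and patching (journal Prop. 4.6) give
`CossartPiltant2019`. [cite: CossartPiltant2019, Ch. 4] -/
theorem cossartPiltant2019_of_local (hloc : CossartPiltant2019Local.{u})
    (hred : CossartPiltant2019ReductionP.{u}) (h0 : CossartPiltant2019LUCompleteChar0.{u})
    (h48 : CossartPiltant2019LU3OfComplete.{u}) (hCJS : CossartJannsenSaito2020.{u})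
    (hP : CossartPiltant2019Patching.{u}) : CossartPiltant2019.{u} :=
  cossartPiltant2019_of_complete hCJS (CossartPiltant2019LUComplete3.of_local hloc hred h0) h48 hP

/-- The leaves of the decomposition, bundled: what remains to be PROVED for
`CossartPiltant2019_holds` along Cossart–Piltant's own architecture. [folklore] -/
theorem cossartPiltant2019_leaves :
    (CossartPiltant2019Local.{u} ∧ CossartPiltant2019ReductionP.{u} ∧
      CossartPiltant2019LUCompleteChar0.{u} ∧ CossartPiltant2019LU3OfComplete.{u} ∧
      CossartJannsenSaito2020.{u} ∧ CossartPiltant2019Patching.{u}) →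
    CossartPiltant2019.{u} :=
  fun ⟨a, b, c, d, e, f⟩ => cossartPiltant2019_of_local a b c d e f

end Literature.AlgebraicGeometry.Resolution

end
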